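import Summits.HodgeConjecture.CorCM.IrreducibleOddWeightsRightIdealsPivotFamilies
import HarnessLib

/-!
# Right ideals, X: the defect of a family is AT LEAST the defect of its fibre sums — unconditionally
# `Σ_i dim Hg(A_i) − dim Hg(∏_i A_i) ≥ Σ_i dim(w_iℚ[Γ]) − dim(Σ_i w_iℚ[Γ])` for the shadows on any torsor pivot

COR-CM (cell `pub-hodgecm2`, binder seat `b16` gen 64, count-neutral claim RIGHT IDEALS, file R10 — abstract `G`-set
level; theorems only, no definition, no named fact, no `sorry`).  NEW as stated, hence under `Summits/`.  HONEST FRAMING: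
finite-dimensional linear algebra about the Kubota–Dodson rank of a family of CM types; `HC_CM` is neither used nor asserted.

SETTING (R1, R3, R5 `IrreducibleOddWeightsRightIdeals{,Pivot,PivotFamilies}`).  Matrix-coefficient spaces `MC_i ≤ ℚ^G`,
fibre-sum spaces `F_i ≤ MC_i` of pivot maps `r_i : E_i → Y`.  R5 proved the EQUALITY of the defects of `(MC_i)` and `(F_i)`
under the gluing hypotheses; here the INEQUALITY that needs nothing: the relations among the `F_i` are relations among the
`MC_i`.

* `sum_finrank_add_finrank_iSup_le_of_le` — bookkeeping: for `B_i ≤ C_i`, `Σ_i dim B_i + dim ⨆_i C_i ≤ Σ_i dim C_i +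
  dim ⨆_i B_i` (the kernel of the summation map of the `B_i` embeds in that of the `C_i`).
* **`typeRank_sigmaType_add_card_add_sum_finrank_fibreSum_le`** — `rank(Σ) + |I| + Σ_i dim F_i ≤ Σ_i rank Φ_i + 1 + dim ⨆_i F_i`:
  **`Σ_i dim Hg(A_i) − dim Hg(∏_i A_i) ≥ Σ_i dim F_i − dim Σ_i F_i`** for ANY maps `r_i` (the family form of R3's
  `typeRank_sigmaType_add_one_add_finrank_inf_fibreSum_le`).
* **`typeRank_sigmaType_add_card_add_sum_finrank_span_precomp_le`** — on a torsor (`G` transitive on `Y`, `q_σ` commuting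
  with `G`, `{q_σ y₀} = Y`, `r_i` equivariant): **`Σ_i dim Hg(A_i) − dim Hg(∏_i A_i) ≥ Σ_i dim(w_iℚ[Γ]) − dim(Σ_i w_iℚ[Γ])`**
  — the defect of the right ideals of the shadows is a LOWER BOUND for the defect of the family, with no hypothesis on
  Galois closures (R5/R5b: equality under (GL)).  CM dress and the pigeonhole in `Anti(Hom(M, ℂ))`: R10b
  `IrreducibleOddWeightsRightIdealsPigeonhole`.

## References

* [Deligne1982HodgeCycles] P. Deligne, *Hodge cycles on abelian varieties*, LNM 900 (1982), I §5, I Ex. 3.7.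
* [Gordon1999HodgeAVSurvey] B. B. Gordon, *A survey of the Hodge conjecture for abelian varieties*, §3 Theorem (proof), 7.5–7.7.
* [Kubota1965] T. Kubota, *On the field extension by complex multiplication*, Trans. AMS 118 (1965), §2, §4 Lemma 2.
-/

set_option autoImplicit false

noncomputable section

open scoped BigOperators

universe u v v' w

namespace Summit.HodgeConjecture.CorCM.IrrOdd

open Literature.NumberTheory.ComplexMultiplication

/-! ### §1 Bookkeeping: smaller subspaces have fewer relations -/

section Bookkeeping

variable {M : Type*} [AddCommGroup M] [Module ℚ M] {ι : Type*} [Fintype ι] [DecidableEq ι]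

/-- **For `B_i ≤ C_i`: `Σ_i dim B_i + dim ⨆_i C_i ≤ Σ_i dim C_i + dim ⨆_i B_i`** — the defect `Σ_i dim − dim ⨆_i` can only
grow with the subspaces (component-wise inclusion embeds the kernel of the summation map of the `B_i` into that of the
`C_i`). [folklore] -/
theorem sum_finrank_add_finrank_iSup_le_of_le (B C : ι → Submodule ℚ M) [∀ i, Module.Finite ℚ (C i)]
    (hBC : ∀ i, B i ≤ C i) :
    (∑ i, Module.finrank ℚ (B i)) + Module.finrank ℚ (⨆ i, C i : Submodule ℚ M) ≤
      (∑ i, Module.finrank ℚ (C i)) + Module.finrank ℚ (⨆ i, B i : Submodule ℚ M) := by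
  haveI : ∀ i, Module.Finite ℚ (B i) := fun i =>
    Module.Finite.of_injective (Submodule.inclusion (hBC i)) (Submodule.inclusion_injective (hBC i))
  let Ψ : (∀ i, ↥(B i)) →ₗ[ℚ] (∀ i, ↥(C i)) :=
    LinearMap.pi fun i => Submodule.inclusion (hBC i) ∘ₗ LinearMap.proj i
  have hΨ : ∀ (v : ∀ i, ↥(B i)) (i : ι), (Ψ v i : M) = (v i : M) := fun v i => rfl
  have hΨinj : Function.Injective Ψ := by
    intro v v' hvv'
    funext i
    apply Subtype.ext
    rw [← hΨ v i, ← hΨ v' i, hvv']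
  have hker : (LinearMap.ker (∑ i, (B i).subtype ∘ₗ LinearMap.proj (R := ℚ) (φ := fun i => ↥(B i)) i)).map Ψ ≤
      LinearMap.ker (∑ i, (C i).subtype ∘ₗ LinearMap.proj (R := ℚ) (φ := fun i => ↥(C i)) i) := by
    rintro _ ⟨v, hv, rfl⟩
    simp only [SetLike.mem_coe, LinearMap.mem_ker, LinearMap.sum_apply] at hv ⊢
    rw [← hv]
    exact Finset.sum_congr rfl fun i _ => hΨ v i
  have hk := Submodule.finrank_mono hker
  rw [LinearEquiv.finrank_eq (Submodule.equivMapOfInjective Ψ hΨinj _).symm] at hk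
  have hB := sum_finrank_eq_finrank_iSup_add_finrank_ker B
  have hC := sum_finrank_eq_finrank_iSup_add_finrank_ker C
  omega

end Bookkeeping

/-! ### §2 The defect of the fibre sums is a lower bound -/

section FibreDefect

variable {G : Type w} [Group G] {I : Type u} {E : I → Type v} [∀ i, MulAction G (E i)] [Fintype I] [DecidableEq I]
  [∀ i, Fintype (E i)] [∀ i, Nonempty (E i)] [Nonempty I] {Y : Type v'} [DecidableEq Y]

/-- **`rank(Σ) + |I| + Σ_i dim F_i ≤ Σ_i rank Φ_i + 1 + dim ⨆_i F_i`** for ANY maps `r_i : E_i → Y`: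
**`Σ_i dim Hg(A_i) − dim Hg(∏_i A_i) ≥ Σ_i dim F_i − dim Σ_i F_i`** — every relation among the fibre sums is a relation among
the matrix coefficients (R1: the defect is `Σ_i dim MC_i − dim Σ_i MC_i`).
[cite: Gordon1999HodgeAVSurvey, §3 Theorem (proof) and 7.7] [cite: Deligne1982HodgeCycles, I §5] -/
theorem typeRank_sigmaType_add_card_add_sum_finrank_fibreSum_le {ρ : G} {Φ : ∀ i, Set (E i)}
    (h : ∀ i, IsCMTypeWith ρ (Φ i)) (r : ∀ i, E i → Y) :
    typeRank G (sigmaType Φ) + Fintype.card I +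
        ∑ i, Module.finrank ℚ (Submodule.span ℚ (Set.range fun y : Y => fun g : G =>
          ∑ x ∈ Finset.univ.filter (fun x => r i x = y), antiVec (Φ i) g x)) ≤
      (∑ i, typeRank G (Φ i)) + 1 + Module.finrank ℚ (⨆ i, Submodule.span ℚ (Set.range fun y : Y => fun g : G =>
          ∑ x ∈ Finset.univ.filter (fun x => r i x = y), antiVec (Φ i) g x) : Submodule ℚ (G → ℚ)) := by
  haveI := fun i => finite_span_coeff (G := G) (Φ i)
  have h1 := typeRank_sigmaType_add_card_add_sum_finrank_eq h
  have h2 := sum_finrank_add_finrank_iSup_le_of_le _ _ (fun i => span_fibreSum_le_span_coeff (G := G) (Φ i) (r i))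
  omega

variable [MulAction G Y] {Γ : Type*}

/-- **THE RIGHT IDEALS OF THE SHADOWS BOUND THE DEFECT FROM BELOW, unconditionally**: on a torsor pivot (`G` transitive on
`Y`, `q_σ` commuting with `G` and reaching every point from `y₀`, `r_i` equivariant),
`rank(Σ) + |I| + Σ_i dim(w_iℚ[Γ]) ≤ Σ_i rank Φ_i + 1 + dim(Σ_i w_iℚ[Γ])`, i.e.
**`Σ_i dim Hg(A_i) − dim Hg(∏_i A_i) ≥ Σ_i dim(w_iℚ[Γ]) − dim(Σ_i w_iℚ[Γ])`** (R5: equality under the gluing hypotheses).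
[cite: Kubota1965, §2 and §4 Lemma 2] [cite: Gordon1999HodgeAVSurvey, §3 Theorem (proof) and 7.5–7.7] -/
theorem typeRank_sigmaType_add_card_add_sum_finrank_span_precomp_le {ρ : G} {Φ : ∀ i, Set (E i)}
    (h : ∀ i, IsCMTypeWith ρ (Φ i)) (r : ∀ i, E i → Y) (hr : ∀ (i : I) (g : G) (x : E i), r i (g • x) = g • r i x)
    (q : Γ → Y → Y) (hq : ∀ (σ : Γ) (g : G) (y : Y), q σ (g • y) = g • q σ y) (y₀ : Y)
    (hcov : ∀ y, ∃ σ, q σ y₀ = y) (htrans : ∀ y : Y, ∃ g : G, g • y₀ = y) :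
    typeRank G (sigmaType Φ) + Fintype.card I +
        ∑ i, Module.finrank ℚ (Submodule.span ℚ (Set.range fun σ : Γ => fun y : Y =>
          ∑ x ∈ Finset.univ.filter (fun x => r i x = q σ y), antiVec (Φ i) (1 : G) x)) ≤
      (∑ i, typeRank G (Φ i)) + 1 + Module.finrank ℚ (⨆ i, Submodule.span ℚ (Set.range fun σ : Γ => fun y : Y =>
          ∑ x ∈ Finset.univ.filter (fun x => r i x = q σ y), antiVec (Φ i) (1 : G) x) : Submodule ℚ (Y → ℚ)) := by
  obtain ⟨hsup, hmem⟩ := finrank_iSup_span_precomp_eq Φ r hr q hq y₀ hcov htrans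
  rw [hsup, Finset.sum_congr rfl fun i _ => hmem i]
  exact typeRank_sigmaType_add_card_add_sum_finrank_fibreSum_le h r

end FibreDefect

end Summit.HodgeConjecture.CorCM.IrrOdd

end
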